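import Literature.MathematicalPhysics.QuantumFieldTheory.BalabanImbrieJaffe1984to88.BIJ88GkEstimate312
import Literature.MathematicalPhysics.QuantumFieldTheory.BalabanImbrieJaffe1984to88.BIJ88Expansion5143KP

/-!
# `BalabanImbrieJaffe1984to88.BIJ88Expansion5143GkBound` — T. Bałaban, J. Imbrie, A. Jaffe, *Effective action and cluster properties of the
abelian Higgs model*, Commun. Math. Phys. **114** (1988) 257–315 [BalabanImbrieJaffe1988]: Sect. 5.14, pp. 309–312 [PDF 53–56] — **the estimate of
`G_k(X_{r′})` FOR THE OBSERVABLE-CARRYING GAS OF (5.14.3)**, i.e. the gas-level estimate of this seat's gen-12 `BIJ88GkEstimate312` INSTANTIATED for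
the `G_k` of gen 11's `BIJ88Expansion5143Obs.corner_ratio_eq_sum_prod_Gk` (polymers = nonempty sets of cubes of the region `W`, supports = the
virtual supports `cvsupp` of `BIJ88Expansion5143Ordered` / `BIJ88VirtualSupports310`, incompatibility = overlapping virtual supports, vacuum
activities `g₃′(∅, X)`, observable activities `g₃′(H(X), X)`), with the Kotecký–Preiss input DISCHARGED from (5.14.4) as in gen 12's
`BIJ88Expansion5143KP` (p. 310: *"It is now a standard exercise to estimate the expansion, using (5.14.4)"*).

p. 312 [PDF 56], verbatim: *"These considerations lead to the following estimate: |G_k(X)| ≤ c(F(X)) (e^β(L^kε/ε₀)^{1/4−α})^{β′|X∖∪X_c|}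
Π_{X_{σ₁}⊂X …} [c(L^kε)^{−m(c)}e^{−m′(c)}]."* p. 310 [PDF 54]: *"(We allow adjustments in β, α, β′, keeping them small.)"*

HONEST FRAMING (cell `lit-balaban`, verbatim): statement-level skeleton of published theorems with citation tags; proofs where landed; nothing here is a claim about the Yang–Mills mass gap.

PDF held: `paper:balaban1988-cmp114-bij-abelian-higgs-effective-action` (journal page = PDF page + 256); pp. 309–312 = PDF 53–56, read this session.

WHAT IS REPRODUCED (unit `lit-balaban-p25`, generation 12 of the Phase-2 proof seat p25; SKELETON rows `C2.Claim@312` (head: typed leaf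
`BIJ88Sect5StatementsPart4.Ineq312`) and `C2.Eq5.14.3-5.14.4` (head: typed leaf `BIJ88Sect5StatementsPart2.Ineq5144`); HOME
`run/shared/lean/pub/lit-balaban/lit-balaban-p25/`):
* §1 GEOMETRY OF VIRTUAL SUPPORTS: `cinc_of_ov` (overlapping virtual supports ⇒ `cinc`, for ANY second polymer), `touches_of_ov'`, the pinning
  polymer `{c}` at a genuine cube (`ov_singleton_of_inl_mem`), the genuine cubes `T(X′) = {v ∈ X′ : v.isLeft}` of a set of virtual cubes:
  `#(cvsupp Y ∩ T) ≤ #Y` (`card_cvsupp_inter_genuine_le`) and every Mayer support set meets `T` (`suppSets_inter_genuine_nonempty`).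
* §2 **`kp1_polysOf`**: the Kotecký–Preiss hypothesis (1) with size functions `a = a₀#`, `d = λ#` for ALL polymers `γ`, from `‖w X‖ ≤ ε^{#X}` on
  connected polymers and `2(Δ+1)²εe^{a₀+λ} ≤ a₀ ≤ 1/2` (the p. 310 *"standard exercise"*, as in `BIJ88Expansion5143KP.isKPVolume_polysOf`).
* §3 **`norm_Gk_le`**: `‖G_k(X′)‖ ≤ e^{2a₀#T} · Σ_{D} (Π_{X∈D}‖wQ X‖) · e^{−λ#((X′∖dsupp D)∩T)}` for the (5.14.3) gas, `D` over the admissible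
  decorated families inside `X′` (pairwise disjoint virtual supports, carrying exactly the slots located in `X′`); **`norm_Gk_le_of_norm5144`** (the
  vacuum activity bound = the `H_β = ∅` instance of (5.14.4) in modulus form, `ε = θ^{β′}`); **`norm_Gk_le_theta`**: with `λ = β″·log(1/θ)` the small
  factor per uncovered genuine cube is `θ^{β″}` — THE PRINTED SHAPE `(…)^{β″|X∖∪X_c|}`, smallness `2(Δ+1)²e^{a₀}θ^{β′−β″} ≤ a₀` (`β″ < β′`:
  *"adjustments in β, α, β′"*); `exists_theta0_gk` (the threshold `θ₀(Δ, a₀, β′−β″)` below which the smallness holds).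
* §4 FROM THE TYPED LEAF (5.14.4) for REAL corner data: `norm_prime_g3_le_of_ineq5144` (every activity, `‖g₃′(H, X)‖ ≤ θ^{#H + β′|X∖H|}`),
  **`norm_Gk_le_of_ineq5144`** (the `G_k` estimate with the vacuum smallness discharged from the leaf) and **`norm_Gk_le_of_ineq5144'`** (also the
  observable factors bounded by the leaf: `Π_{X∈D} θ^{#H(X) + β′|X∖H(X)|}`).
HONEST SCOPE: (a) (5.14.4) is NOT proved (typed leaf, row C2.Eq5.14.3-5.14.4); (b) in the paper the observable factors are LARGE
(`c(L^kε)^{−m(c)}e^{−m′(c)}`) and are beaten by the integrations by parts of Sect. 5.12 — here they are whatever the activity `wQ` is (`§3`) or what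
the leaf gives (`§4`); (c) the boundary refinement of p. 312 is not modelled; (d) constants (`e^{2a₀#T}`, the smallness conditions) are not the
printed ones; (e) the typed leaf `Ineq312` is NOT asserted. 0 `sorry`, 0 new `Prop` facts (D-0026); theorems only; imports `BIJ88GkEstimate312`,
`BIJ88Expansion5143KP`; modifies nothing. NOT summit progress; NOT continuum; NOT Clay. Cell `lit-balaban` Phase 2, seat p25 gen 12 (rows owner
r16, referee ref-5).
-/

noncomputable section

open Finset
open Literature.Probability.LatticeModels
open Literature.MathematicalPhysics.QuantumFieldTheory.BalabanImbrieJaffe1984to88.BIJ88VirtualSupports310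
open Literature.MathematicalPhysics.QuantumFieldTheory.BalabanImbrieJaffe1984to88.BIJ88Expansion5143
open Literature.MathematicalPhysics.QuantumFieldTheory.BalabanImbrieJaffe1984to88.BIJ88Expansion5143Ordered
open Literature.MathematicalPhysics.QuantumFieldTheory.BalabanImbrieJaffe1984to88.BIJ88ObservableGas312
open Literature.MathematicalPhysics.QuantumFieldTheory.BalabanImbrieJaffe1984to88.BIJ88ClusterSupports312
open Literature.MathematicalPhysics.QuantumFieldTheory.BalabanImbrieJaffe1984to88.BIJ88SupportRegrouping312
open Literature.MathematicalPhysics.QuantumFieldTheory.BalabanImbrieJaffe1984to88.BIJ88ObservableFactorization312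
open Literature.MathematicalPhysics.QuantumFieldTheory.BalabanImbrieJaffe1984to88.BIJ88Expansion5143Obs
open Literature.MathematicalPhysics.QuantumFieldTheory.BalabanImbrieJaffe1984to88.BIJ88Expansion5143KP
open Literature.MathematicalPhysics.QuantumFieldTheory.BalabanImbrieJaffe1984to88.BIJ88GkEstimate312
open Literature.MathematicalPhysics.QuantumFieldTheory.BalabanImbrieJaffe1984to88.BIJ88Ineq5113Covering (cubeSys)

namespace Literature.MathematicalPhysics.QuantumFieldTheory.BalabanImbrieJaffe1984to88.BIJ88Expansion5143GkBound

/-! ## §1 Geometry of virtual supports: overlap with any polymer, genuine cubes, pinning polymers -/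

section Geometry

variable {ι : Type*} [DecidableEq ι] {adj : ι → ι → Prop} [DecidableRel adj] {W : Finset ι}

/-- **overlapping virtual supports ⇒ incompatible**, for ANY second polymer `γ` (membership in `polysOf W` is needed only for the converse,
`BIJ88Expansion5143Obs.ov_cvsupp_iff`). [cite: BalabanImbrieJaffe1988, p.310 (Sect. 5.14)] -/
theorem cinc_of_ov {Y γ : Finset ι} (h : Ov (cvsupp adj W) Y γ) : cinc adj Y γ := by
  have h' : ¬ Disjoint (cvsupp adj W Y) (cvsupp adj W γ) := h
  obtain ⟨e, heY, heγ⟩ := not_disjoint_iff.1 h'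
  rcases e with c | ⟨x, y⟩
  · exact cinc_of_not_disjoint Y γ (not_disjoint_iff.2 ⟨c, inl_mem_vsupp_iff.1 heY, inl_mem_vsupp_iff.1 heγ⟩)
  · rcases of_inr_mem_vsupp heY with ⟨hxp, -⟩ | ⟨hyp, hx⟩ <;> rcases of_inr_mem_vsupp heγ with ⟨hxq, -⟩ | ⟨hyq, hx'⟩
    · exact (hxp.symm.trans hxq) ▸ cinc_refl Y
    · exact cinc_symm (hxp ▸ hx')
    · exact hxq ▸ hx
    · exact (hyp.symm.trans hyq) ▸ cinc_refl Y

/-- hence: overlapping virtual supports ⇒ equal or touching (for a symmetric abutting relation). [cite: BalabanImbrieJaffe1988, p.310 (Sect. 5.14)] -/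
theorem touches_of_ov' (hR : ∀ x y, adj x y → adj y x) {Y γ : Finset ι} (h : Ov (cvsupp adj W) Y γ) : Y = γ ∨ Touches adj γ Y :=
  touches_of_cinc hR (cinc_of_ov h)

/-- **the one-cube polymer `{c}` pins the genuine cube `inl c`**: every polymer whose virtual support contains `inl c` overlaps `{c}`.
[cite: BalabanImbrieJaffe1988, p.312 (Sect. 5.14)] -/
theorem ov_singleton_of_inl_mem {Y : Finset ι} {c : ι} (h : (Sum.inl c : ι ⊕ (Finset ι × Finset ι)) ∈ cvsupp adj W Y) :
    Ov (cvsupp adj W) Y {c} :=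
  fun hd => disjoint_left.1 hd h (inl_mem_vsupp_iff.2 (mem_singleton_self c))

/-- **the genuine cubes of a virtual support are the cubes of the polymer**: `#(cvsupp Y ∩ {v ∈ X′ : v genuine}) ≤ #Y` (the pair tags do not
count towards the size). [cite: BalabanImbrieJaffe1988, p.310 (Sect. 5.14)] -/
theorem card_cvsupp_inter_genuine_le (Y : Finset ι) (X' : Finset (ι ⊕ (Finset ι × Finset ι))) :
    (cvsupp adj W Y ∩ X'.filter fun v => v.isLeft).card ≤ Y.card := by
  calc (cvsupp adj W Y ∩ X'.filter fun v => v.isLeft).card ≤ (Y.image (Sum.inl : ι → ι ⊕ (Finset ι × Finset ι))).card := by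
        refine card_le_card fun v hv => ?_
        obtain ⟨hvY, hvX⟩ := mem_inter.1 hv
        obtain ⟨c, rfl⟩ := Sum.isLeft_iff.1 (mem_filter.1 hvX).2
        exact mem_image_of_mem _ (inl_mem_vsupp_iff.1 hvY)
    _ ≤ Y.card := card_image_le

/-- **every Mayer support set meets the genuine cubes**: a nonempty union of virtual supports of polymers of `W` inside `X′` contains a genuine
cube of `X′` (polymers are nonempty). [cite: BalabanImbrieJaffe1988, p.312 (Sect. 5.14)] -/
theorem suppSets_inter_genuine_nonempty {S X' : Finset (ι ⊕ (Finset ι × Finset ι))} (hS : S ∈ suppSets (cvsupp adj W) (polysOf W))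
    (hSX : S ⊆ X') : (S ∩ X'.filter fun v => v.isLeft).Nonempty := by
  obtain ⟨hS', hne⟩ := mem_suppSets.1 hS
  unfold supports at hS'
  obtain ⟨C, hC, rfl⟩ := mem_image.1 hS'
  obtain ⟨e, he⟩ := hne
  obtain ⟨Y, hY, -⟩ := mem_csupp.1 he
  obtain ⟨c, hc⟩ := (mem_polysOf.1 (mem_powerset.1 hC hY)).2
  have hcS : (Sum.inl c : ι ⊕ (Finset ι × Finset ι)) ∈ csupp (cvsupp adj W) C := mem_csupp.2 ⟨Y, hY, inl_mem_vsupp_iff.2 hc⟩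
  exact ⟨Sum.inl c, mem_inter.2 ⟨hcS, mem_filter.2 ⟨hSX hcS, rfl⟩⟩⟩

end Geometry

/-! ## §2 The Kotecký–Preiss hypothesis (1) with `a = a₀#`, `d = λ#`, for all polymers -/

section KP

variable {ι : Type*} [DecidableEq ι] {adj : ι → ι → Prop} [DecidableRel adj] {nbr : ι → Finset ι} {Δ : ℕ} {W : Finset ι}

/-- **KP (1) WITH A `d`-TERM FOR THE VACUUM GAS OF (5.14.3)** (p. 310 *"standard exercise"*): if the activities vanish off the `adj`-connected polymers
and `‖w X‖ ≤ ε^{#X}` (`0 ≤ ε`), and `2(Δ+1)²εe^{a₀+λ} ≤ a₀ ≤ 1/2` (abutting relation symmetric of degree `≤ Δ`), then for EVERY polymer `γ`: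
`Σ_{Y ∈ polysOf W, vsupp Y ∩ vsupp γ ≠ ∅} ‖w Y‖ e^{a₀#Y + λ#Y} ≤ a₀#γ` (any real `λ`). [cite: BalabanImbrieJaffe1988, p.310 (Sect. 5.14)] -/
theorem kp1_polysOf (hR : ∀ x y, adj x y → adj y x) (hΔ : ∀ x, (nbr x).card ≤ Δ) (hnbr : ∀ x y, adj x y → y ∈ nbr x) {ε a₀ lam : ℝ}
    (hε : 0 ≤ ε) (ha₀ : a₀ ≤ 1 / 2) (hsmall : 2 * ((Δ : ℝ) + 1) ^ 2 * ε * Real.exp (a₀ + lam) ≤ a₀) {w : Finset ι → ℂ}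
    (hz0 : ∀ X ∈ polysOf W, ¬ IsRConnected adj X → w X = 0) (hz : ∀ X ∈ polysOf W, ‖w X‖ ≤ ε ^ X.card) (γ : Finset ι) :
    ∑ Y ∈ polysOf W with Ov (cvsupp adj W) Y γ, ‖w Y‖ * Real.exp (a₀ * Y.card + lam * Y.card) ≤ a₀ * γ.card := by
  set μ : ℝ := ε * Real.exp (a₀ + lam) with hμ
  have hμ0 : 0 ≤ μ := mul_nonneg hε (Real.exp_pos _).le
  have hΔ0 : (0 : ℝ) ≤ Δ := Nat.cast_nonneg Δ
  have hkey : ((Δ : ℝ) + 1) ^ 2 * μ = (2 * ((Δ : ℝ) + 1) ^ 2 * ε * Real.exp (a₀ + lam)) / 2 := by rw [hμ]; ring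
  have hsmall₁ : ((Δ : ℝ) + 1) ^ 2 * μ ≤ 1 / 2 := by rw [hkey]; linarith
  have hsmall₂ : ((Δ : ℝ) + 1) * (2 * μ) ≤ a₀ := by
    have h1 : ((Δ : ℝ) + 1) ≤ ((Δ : ℝ) + 1) ^ 2 := by nlinarith
    calc ((Δ : ℝ) + 1) * (2 * μ) ≤ ((Δ : ℝ) + 1) ^ 2 * (2 * μ) := mul_le_mul_of_nonneg_right h1 (by positivity)
      _ = 2 * ((Δ : ℝ) + 1) ^ 2 * ε * Real.exp (a₀ + lam) := by rw [hμ]; ring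
      _ ≤ a₀ := hsmall
  set F : Finset (Finset ι) := (polysOf W).filter fun Y => Ov (cvsupp adj W) Y γ with hF
  have h𝒩 : ∀ Y ∈ F, Y = γ ∨ Touches adj γ Y := fun Y hY => touches_of_ov' hR (mem_filter.1 hY).2
  calc ∑ Y ∈ F, ‖w Y‖ * Real.exp (a₀ * Y.card + lam * Y.card)
      ≤ ∑ Y ∈ F, kpWeight adj μ Y := by
        refine sum_le_sum fun Y hY => ?_
        have hYW : Y ∈ polysOf W := (mem_filter.1 hY).1
        have hexp : Real.exp (a₀ * Y.card + lam * Y.card) = Real.exp (a₀ + lam) ^ Y.card := by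
          rw [← Real.exp_nat_mul]; congr 1; ring
        by_cases hc : IsRConnected adj Y
        · rw [kpWeight, if_pos hc, hexp, hμ, mul_pow]
          exact mul_le_mul_of_nonneg_right (hz Y hYW) (pow_nonneg (Real.exp_pos _).le _)
        · rw [hz0 Y hYW hc, norm_zero, zero_mul]
          exact kpWeight_nonneg _ hμ0 Y
    _ ≤ γ.card * ((Δ : ℝ) + 1) * (2 * μ) := sum_kpWeight_le_of_touches hR hΔ hnbr hμ0 hsmall₁ γ F h𝒩
    _ = γ.card * (((Δ : ℝ) + 1) * (2 * μ)) := by ring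
    _ ≤ γ.card * a₀ := mul_le_mul_of_nonneg_left hsmall₂ (Nat.cast_nonneg _)
    _ = a₀ * γ.card := mul_comm _ _

end KP

/-! ## §3 The estimate of `G_k(X′)` for the gas of (5.14.3) -/

section Main

variable {ι : Type*} [DecidableEq ι] [Fintype ι] {S : Type*} [DecidableEq S] {adj : ι → ι → Prop} [DecidableRel adj] {nbr : ι → Finset ι}
  {Δ : ℕ} {W : Finset ι} {loc : S → ι} {K : Finset S}

/-- **THE p. 312 ESTIMATE OF `G_k(X′)` FOR THE OBSERVABLE-CARRYING GAS OF (5.14.3)** (virtual cubes `ι ⊕ (Finset ι × Finset ι)`, genuine cubes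
`T = {v ∈ X′ : v.isLeft}`): for vacuum activities vanishing off connected polymers with `‖w X‖ ≤ ε^{#X}` and `2(Δ+1)²εe^{a₀+λ} ≤ a₀ ≤ 1/2`
(`ε, λ ≥ 0`), and ANY observable activities `wQ`,
`‖G_k(X′)‖ ≤ e^{2a₀#T} · Σ_{D ⊆ obsPolys, pairwise disjoint virtual supports inside X′, carrying exactly the slots located in X′} (Π_{X∈D}‖wQ X‖) ·
e^{−λ·#((X′ ∖ dsupp D) ∩ T)}` — observable factors × a small factor `e^{−λ}` per genuine cube of `X′` outside the observable-carrying polymers × a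
combinatoric factor. [cite: BalabanImbrieJaffe1988, (5.14.5) p.312] -/
theorem norm_Gk_le (hR : ∀ x y, adj x y → adj y x) (hΔ : ∀ x, (nbr x).card ≤ Δ) (hnbr : ∀ x y, adj x y → y ∈ nbr x) {ε a₀ lam : ℝ}
    (hε : 0 ≤ ε) (hlam : 0 ≤ lam) (ha₀ : a₀ ≤ 1 / 2) (hsmall : 2 * ((Δ : ℝ) + 1) ^ 2 * ε * Real.exp (a₀ + lam) ≤ a₀) {w : Finset ι → ℂ}
    (hz0 : ∀ X ∈ polysOf W, ¬ IsRConnected adj X → w X = 0) (hz : ∀ X ∈ polysOf W, ‖w X‖ ≤ ε ^ X.card) (wQ : Finset ι → ℂ)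
    (X' : Finset (ι ⊕ (Finset ι × Finset ι))) :
    ‖Gk (cvsupp adj W) (cvsupp adj W) (slotsIn loc K) (locv1 loc) K (obsPolys W loc K) wQ (Ov (cvsupp adj W)) w (polysOf W) X'‖ ≤
      Real.exp (2 * a₀ * (X'.filter fun v => v.isLeft).card) *
        ∑ D ∈ (obsPolys W loc K).powerset with ((∀ X ∈ D, ∀ X₂ ∈ D, X ≠ X₂ → Disjoint (cvsupp adj W X) (cvsupp adj W X₂)) ∧
            D.biUnion (slotsIn loc K) = obsIn (locv1 loc) K X' ∧ dsupp (cvsupp adj W) D ⊆ X'),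
          (∏ X ∈ D, ‖wQ X‖) * Real.exp (-(lam * ((X' \ dsupp (cvsupp adj W) D) ∩ X'.filter fun v => v.isLeft).card)) := by
  have ha0 : 0 ≤ a₀ := le_trans (mul_nonneg (mul_nonneg (by positivity) hε) (Real.exp_pos _).le) hsmall
  have hη1 : 2 * a₀ ≤ 1 := by linarith
  have hT : ∀ S ∈ suppSets (cvsupp adj W) (polysOf W), S ⊆ X' → (S ∩ X'.filter fun v => v.isLeft).Nonempty :=
    fun S hS hSX => suppSets_inter_genuine_nonempty hS hSX
  have hdlam : ∀ Y ∈ polysOf W, lam * ((cvsupp adj W Y ∩ X'.filter fun v => v.isLeft).card : ℝ) ≤ lam * (Y.card : ℝ) :=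
    fun Y _ => mul_le_mul_of_nonneg_left (by exact_mod_cast card_cvsupp_inter_genuine_le Y X') hlam
  have hpin : ∀ x ∈ X'.filter (fun v => v.isLeft), ∃ σ₀ : Finset ι, a₀ * (σ₀.card : ℝ) ≤ 2 * a₀ / 2 ∧
      ∀ Y ∈ polysOf W, x ∈ cvsupp adj W Y → Ov (cvsupp adj W) Y σ₀ := by
    intro x hx
    obtain ⟨c, rfl⟩ := Sum.isLeft_iff.1 (mem_filter.1 hx).2
    refine ⟨{c}, ?_, fun Y _ hY => ov_singleton_of_inl_mem hY⟩
    rw [card_singleton, Nat.cast_one, mul_one]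
    linarith
  have h := norm_Gk_le_of_kp (supp := cvsupp adj W) (suppQ := cvsupp adj W) (obs := slotsIn loc K) (loc := locv1 loc) (Rset := K)
    (𝒬 := obsPolys W loc K) (Λ := polysOf W) wQ (inc := Ov (cvsupp adj W)) (w := w) (a := fun γ => a₀ * (γ.card : ℝ))
    (d := fun γ => lam * (γ.card : ℝ)) (fun γ => mul_nonneg ha0 (Nat.cast_nonneg _)) (fun γ => mul_nonneg hlam (Nat.cast_nonneg _)) hlam
    hη1 X' (X'.filter fun v => v.isLeft) hT hdlam (kp1_polysOf hR hΔ hnbr hε ha₀ hsmall hz0 hz) hpin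
  -- (`exact h` makes the unifier unfold the admissible-family filter; `convert` closes the decidability instances by `Subsingleton`)
  convert h using 4

/-- **THE SAME WITH THE VACUUM SMALLNESS FROM (5.14.4)** (`H_β = ∅` instance in modulus form: `‖g₃′(∅, X)‖ ≤ θ^{β′#X}` on the polymers of `W`,
`0 ≤ θ`, `ε = θ^{β′}`), for the activities of gen 11's `corner_ratio_eq_sum_prod_Gk`: vacuum `g₃′(∅, ·)`, observable `g₃′(H(X), X)` with
`H(X) = slotsIn loc K X`. [cite: BalabanImbrieJaffe1988, (5.14.4) p.309, (5.14.5) p.312] -/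
theorem norm_Gk_le_of_norm5144 (hR : ∀ x y, adj x y → adj y x) (hΔ : ∀ x, (nbr x).card ≤ Δ) (hnbr : ∀ x y, adj x y → y ∈ nbr x)
    {θ β' a₀ lam : ℝ} (hθ : 0 ≤ θ) (hlam : 0 ≤ lam) (ha₀ : a₀ ≤ 1 / 2) (hsmall : 2 * ((Δ : ℝ) + 1) ^ 2 * θ ^ β' * Real.exp (a₀ + lam) ≤ a₀)
    {z : Finset S → Finset ι → Finset ι → ℂ} (h5144 : ∀ X ∈ polysOf W, ‖prime (g3 adj z) ∅ X‖ ≤ θ ^ (β' * (X.card : ℝ)))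
    (X' : Finset (ι ⊕ (Finset ι × Finset ι))) :
    ‖Gk (cvsupp adj W) (cvsupp adj W) (slotsIn loc K) (locv1 loc) K (obsPolys W loc K) (fun X => prime (g3 adj z) (slotsIn loc K X) X)
        (Ov (cvsupp adj W)) (fun X => prime (g3 adj z) ∅ X) (polysOf W) X'‖ ≤
      Real.exp (2 * a₀ * (X'.filter fun v => v.isLeft).card) *
        ∑ D ∈ (obsPolys W loc K).powerset with ((∀ X ∈ D, ∀ X₂ ∈ D, X ≠ X₂ → Disjoint (cvsupp adj W X) (cvsupp adj W X₂)) ∧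
            D.biUnion (slotsIn loc K) = obsIn (locv1 loc) K X' ∧ dsupp (cvsupp adj W) D ⊆ X'),
          (∏ X ∈ D, ‖prime (g3 adj z) (slotsIn loc K X) X‖) *
            Real.exp (-(lam * ((X' \ dsupp (cvsupp adj W) D) ∩ X'.filter fun v => v.isLeft).card)) := by
  refine norm_Gk_le hR hΔ hnbr (Real.rpow_nonneg hθ β') hlam ha₀ hsmall (fun X hX hc => ?_) (fun X hX => ?_) _ X'
  · by_contra h
    exact hc (isRConnected_of_prime_g3_ne_zero hR z ∅ (mem_polysOf.1 hX).2 h)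
  · rw [← Real.rpow_natCast, ← Real.rpow_mul hθ]
    exact h5144 X hX

omit [DecidableEq ι] [Fintype ι] [DecidableEq S] [DecidableRel adj] in
/-- `e^{−λn} = θ^{β″n}` for `λ = β″·log(1/θ)`. [cite: BalabanImbrieJaffe1988, p.310 (Sect. 5.14)] -/
theorem exp_neg_mul_eq_rpow {θ : ℝ} (hθ0 : 0 < θ) (β'' n : ℝ) : Real.exp (-(-(β'' * Real.log θ) * n)) = θ ^ (β'' * n) := by
  rw [Real.rpow_def_of_pos hθ0]
  congr 1
  ring

omit [DecidableEq ι] [Fintype ι] [DecidableEq S] [DecidableRel adj] in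
/-- the smallness in `θ`-form: `θ^{β′}e^{a₀+λ} = e^{a₀}θ^{β′−β″}` for `λ = β″·log(1/θ)`. [cite: BalabanImbrieJaffe1988, p.310 (Sect. 5.14)] -/
theorem rpow_mul_exp_add_eq {θ : ℝ} (hθ0 : 0 < θ) (β' β'' a₀ : ℝ) :
    θ ^ β' * Real.exp (a₀ + -(β'' * Real.log θ)) = θ ^ (β' - β'') * Real.exp a₀ := by
  have h1 : Real.exp (-(β'' * Real.log θ)) = θ ^ (-β'') := by
    rw [Real.rpow_def_of_pos hθ0]
    congr 1
    ring
  rw [Real.exp_add, h1, sub_eq_add_neg, Real.rpow_add hθ0]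
  ring

/-- **THE PRINTED SHAPE**: with `λ = β″·log(1/θ)` (`0 < θ ≤ 1`, `0 ≤ β″`) the small factor per genuine cube of `X′` outside the observable-carrying
polymers is `θ^{β″}` — *"(e^β(L^kε/ε₀)^{1/4−α})^{β′|X∖∪X_c|}"* with an adjusted exponent (p. 310: *"We allow adjustments in β, α, β′"*), the smallness
condition being `2(Δ+1)²e^{a₀}θ^{β′−β″} ≤ a₀ ≤ 1/2`:
`‖G_k(X′)‖ ≤ e^{2a₀#T} · Σ_D (Π_{X∈D}‖g₃′(H(X), X)‖) · θ^{β″·#((X′ ∖ dsupp D) ∩ T)}`. [cite: BalabanImbrieJaffe1988, (5.14.5) p.312] -/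
theorem norm_Gk_le_theta (hR : ∀ x y, adj x y → adj y x) (hΔ : ∀ x, (nbr x).card ≤ Δ) (hnbr : ∀ x y, adj x y → y ∈ nbr x)
    {θ β' β'' a₀ : ℝ} (hθ0 : 0 < θ) (hθ1 : θ ≤ 1) (hβ'' : 0 ≤ β'') (ha₀ : a₀ ≤ 1 / 2)
    (hsmall : 2 * ((Δ : ℝ) + 1) ^ 2 * θ ^ (β' - β'') * Real.exp a₀ ≤ a₀) {z : Finset S → Finset ι → Finset ι → ℂ}
    (h5144 : ∀ X ∈ polysOf W, ‖prime (g3 adj z) ∅ X‖ ≤ θ ^ (β' * (X.card : ℝ))) (X' : Finset (ι ⊕ (Finset ι × Finset ι))) :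
    ‖Gk (cvsupp adj W) (cvsupp adj W) (slotsIn loc K) (locv1 loc) K (obsPolys W loc K) (fun X => prime (g3 adj z) (slotsIn loc K X) X)
        (Ov (cvsupp adj W)) (fun X => prime (g3 adj z) ∅ X) (polysOf W) X'‖ ≤
      Real.exp (2 * a₀ * (X'.filter fun v => v.isLeft).card) *
        ∑ D ∈ (obsPolys W loc K).powerset with ((∀ X ∈ D, ∀ X₂ ∈ D, X ≠ X₂ → Disjoint (cvsupp adj W X) (cvsupp adj W X₂)) ∧
            D.biUnion (slotsIn loc K) = obsIn (locv1 loc) K X' ∧ dsupp (cvsupp adj W) D ⊆ X'),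
          (∏ X ∈ D, ‖prime (g3 adj z) (slotsIn loc K X) X‖) *
            θ ^ (β'' * (((X' \ dsupp (cvsupp adj W) D) ∩ X'.filter fun v => v.isLeft).card : ℝ)) := by
  have hlog : Real.log θ ≤ 0 := Real.log_nonpos hθ0.le hθ1
  have hlam : 0 ≤ -(β'' * Real.log θ) := by nlinarith [mul_nonneg hβ'' (neg_nonneg.2 hlog)]
  have hsmall' : 2 * ((Δ : ℝ) + 1) ^ 2 * θ ^ β' * Real.exp (a₀ + -(β'' * Real.log θ)) ≤ a₀ := by
    calc 2 * ((Δ : ℝ) + 1) ^ 2 * θ ^ β' * Real.exp (a₀ + -(β'' * Real.log θ))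
        = 2 * ((Δ : ℝ) + 1) ^ 2 * (θ ^ β' * Real.exp (a₀ + -(β'' * Real.log θ))) := by ring
      _ = 2 * ((Δ : ℝ) + 1) ^ 2 * θ ^ (β' - β'') * Real.exp a₀ := by rw [rpow_mul_exp_add_eq hθ0]; ring
      _ ≤ a₀ := hsmall
  have h := norm_Gk_le_of_norm5144 (loc := loc) (K := K) hR hΔ hnbr hθ0.le hlam ha₀ hsmall' h5144 X'
  simp only [exp_neg_mul_eq_rpow hθ0] at h
  exact h

omit [DecidableEq ι] [Fintype ι] [DecidableEq S] [DecidableRel adj] in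
/-- **THE THRESHOLD `θ₀(Δ, a₀, β′−β″)`** (p. 310: *"(We allow adjustments in β, α, β′, keeping them small.)"*): for `a₀ > 0` and `β″ < β′`
the smallness condition `2(Δ+1)²e^{a₀}θ^{β′−β″} ≤ a₀` of `norm_Gk_le_theta` holds for every vertex factor `0 ≤ θ ≤ θ₀`.
[cite: BalabanImbrieJaffe1988, p.310 (Sect. 5.14)] -/
theorem exists_theta0_gk (Δ : ℕ) {a₀ β' β'' : ℝ} (ha₀ : 0 < a₀) (hβ : β'' < β') :
    ∃ θ₀ : ℝ, 0 < θ₀ ∧ ∀ θ : ℝ, 0 ≤ θ → θ ≤ θ₀ → 2 * ((Δ : ℝ) + 1) ^ 2 * θ ^ (β' - β'') * Real.exp a₀ ≤ a₀ := by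
  set c : ℝ := 2 * ((Δ : ℝ) + 1) ^ 2 * Real.exp a₀ / a₀ with hc
  have hc0 : 0 < c := by positivity
  have hδ : 0 < β' - β'' := sub_pos.2 hβ
  refine ⟨(c⁻¹) ^ (1 / (β' - β'')), by positivity, fun θ hθ hle => ?_⟩
  have hpow : θ ^ (β' - β'') ≤ c⁻¹ := by
    calc θ ^ (β' - β'') ≤ ((c⁻¹) ^ (1 / (β' - β''))) ^ (β' - β'') := Real.rpow_le_rpow hθ hle hδ.le
      _ = c⁻¹ := by
          rw [← Real.rpow_mul (inv_nonneg.2 hc0.le), one_div_mul_cancel hδ.ne', Real.rpow_one]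
  calc 2 * ((Δ : ℝ) + 1) ^ 2 * θ ^ (β' - β'') * Real.exp a₀ = (c * a₀) * θ ^ (β' - β'') := by
        rw [hc, div_mul_cancel₀ _ ha₀.ne']; ring
    _ ≤ (c * a₀) * c⁻¹ := by gcongr
    _ = a₀ := by rw [mul_comm c, mul_assoc, mul_inv_cancel₀ hc0.ne', mul_one]

end Main

/-! ## §4 From the typed leaf (5.14.4) of `BIJ88Sect5StatementsPart2`, for REAL corner data

`BIJ88Sect5StatementsPart2.PolymerSys.Poly` lives in `Type` (so does `cubeSys`); so do the statements mentioning the leaf. -/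

section Leaf

variable {ι : Type} [DecidableEq ι] [Fintype ι] {S : Type} [DecidableEq S] {adj : ι → ι → Prop} [DecidableRel adj] {nbr : ι → Finset ι}
  {Δ : ℕ} {W : Finset ι} {loc : S → ι} {K : Finset S}

omit [Fintype ι] in
/-- **(5.14.4) verbatim from the typed leaf, every `H`**: `‖g₃′(H, X)‖ ≤ θ^{#H + β′|X∖H|}` for the complexified activities of real corner data `zr`
(`|X_β∖H_β| = (X ∖ H.image loc).card`, p. 309: *"the set of cubes with no (d/dt)_{γ_j} factors"*). [cite: BalabanImbrieJaffe1988, (5.14.4) p.309] -/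
theorem norm_prime_g3_le_of_ineq5144 {zr : Finset S → Finset ι → Finset ι → ℝ} {θ β' : ℝ}
    (h : BIJ88Sect5StatementsPart2.Ineq5144 (cubeSys ι) (Finset S) (prime (g3 adj zr)) Finset.card
      (fun H (X : Finset ι) => (X \ H.image loc).card) θ β') (H : Finset S) (X : Finset ι) :
    ‖prime (g3 adj fun K X Λ => ((zr K X Λ : ℝ) : ℂ)) H X‖ ≤ θ ^ ((H.card : ℝ) + β' * ((X \ H.image loc).card : ℝ)) := by
  rw [norm_prime_g3_cpx]
  exact h H X

/-- **THE `G_k` ESTIMATE FOR THE GAS OF (5.14.3) WITH THE VACUUM SMALLNESS DISCHARGED FROM THE TYPED LEAF (5.14.4)**, real corner data `zr`,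
`0 < θ ≤ 1`, `0 ≤ β″`, `2(Δ+1)²e^{a₀}θ^{β′−β″} ≤ a₀ ≤ 1/2`: `‖G_k(X′)‖ ≤ e^{2a₀#T} Σ_D (Π_{X∈D}‖g₃′(H(X), X)‖) θ^{β″#((X′∖dsupp D)∩T)}`.
[cite: BalabanImbrieJaffe1988, (5.14.4) p.309, (5.14.5) p.312] -/
theorem norm_Gk_le_of_ineq5144 (hR : ∀ x y, adj x y → adj y x) (hΔ : ∀ x, (nbr x).card ≤ Δ) (hnbr : ∀ x y, adj x y → y ∈ nbr x)
    {θ β' β'' a₀ : ℝ} (hθ0 : 0 < θ) (hθ1 : θ ≤ 1) (hβ'' : 0 ≤ β'') (ha₀ : a₀ ≤ 1 / 2)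
    (hsmall : 2 * ((Δ : ℝ) + 1) ^ 2 * θ ^ (β' - β'') * Real.exp a₀ ≤ a₀) {zr : Finset S → Finset ι → Finset ι → ℝ}
    (h : BIJ88Sect5StatementsPart2.Ineq5144 (cubeSys ι) (Finset S) (prime (g3 adj zr)) Finset.card
      (fun H (X : Finset ι) => (X \ H.image loc).card) θ β') (X' : Finset (ι ⊕ (Finset ι × Finset ι))) :
    ‖Gk (cvsupp adj W) (cvsupp adj W) (slotsIn loc K) (locv1 loc) K (obsPolys W loc K)
        (fun X => prime (g3 adj fun K X Λ => ((zr K X Λ : ℝ) : ℂ)) (slotsIn loc K X) X) (Ov (cvsupp adj W))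
        (fun X => prime (g3 adj fun K X Λ => ((zr K X Λ : ℝ) : ℂ)) ∅ X) (polysOf W) X'‖ ≤
      Real.exp (2 * a₀ * (X'.filter fun v => v.isLeft).card) *
        ∑ D ∈ (obsPolys W loc K).powerset with ((∀ X ∈ D, ∀ X₂ ∈ D, X ≠ X₂ → Disjoint (cvsupp adj W X) (cvsupp adj W X₂)) ∧
            D.biUnion (slotsIn loc K) = obsIn (locv1 loc) K X' ∧ dsupp (cvsupp adj W) D ⊆ X'),
          (∏ X ∈ D, ‖prime (g3 adj fun K X Λ => ((zr K X Λ : ℝ) : ℂ)) (slotsIn loc K X) X‖) *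
            θ ^ (β'' * (((X' \ dsupp (cvsupp adj W) D) ∩ X'.filter fun v => v.isLeft).card : ℝ)) :=
  norm_Gk_le_theta hR hΔ hnbr hθ0 hθ1 hβ'' ha₀ hsmall (fun X _ => norm5144_of_ineq5144 h X) X'

/-- **… AND WITH THE OBSERVABLE FACTORS BOUNDED BY THE LEAF TOO**: `Π_{X∈D}‖g₃′(H(X), X)‖ ≤ Π_{X∈D} θ^{#H(X) + β′|X∖H(X)|}`, `H(X) = slotsIn loc K X`
(in the paper the observable factors are the LARGE `c(L^kε)^{−m(c)}e^{−m′(c)}`; the typed leaf (5.14.4) as stated bounds them by small factors).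
[cite: BalabanImbrieJaffe1988, (5.14.4) p.309, (5.14.5) p.312] -/
theorem norm_Gk_le_of_ineq5144' (hR : ∀ x y, adj x y → adj y x) (hΔ : ∀ x, (nbr x).card ≤ Δ) (hnbr : ∀ x y, adj x y → y ∈ nbr x)
    {θ β' β'' a₀ : ℝ} (hθ0 : 0 < θ) (hθ1 : θ ≤ 1) (hβ'' : 0 ≤ β'') (ha₀ : a₀ ≤ 1 / 2)
    (hsmall : 2 * ((Δ : ℝ) + 1) ^ 2 * θ ^ (β' - β'') * Real.exp a₀ ≤ a₀) {zr : Finset S → Finset ι → Finset ι → ℝ}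
    (h : BIJ88Sect5StatementsPart2.Ineq5144 (cubeSys ι) (Finset S) (prime (g3 adj zr)) Finset.card
      (fun H (X : Finset ι) => (X \ H.image loc).card) θ β') (X' : Finset (ι ⊕ (Finset ι × Finset ι))) :
    ‖Gk (cvsupp adj W) (cvsupp adj W) (slotsIn loc K) (locv1 loc) K (obsPolys W loc K)
        (fun X => prime (g3 adj fun K X Λ => ((zr K X Λ : ℝ) : ℂ)) (slotsIn loc K X) X) (Ov (cvsupp adj W))
        (fun X => prime (g3 adj fun K X Λ => ((zr K X Λ : ℝ) : ℂ)) ∅ X) (polysOf W) X'‖ ≤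
      Real.exp (2 * a₀ * (X'.filter fun v => v.isLeft).card) *
        ∑ D ∈ (obsPolys W loc K).powerset with ((∀ X ∈ D, ∀ X₂ ∈ D, X ≠ X₂ → Disjoint (cvsupp adj W X) (cvsupp adj W X₂)) ∧
            D.biUnion (slotsIn loc K) = obsIn (locv1 loc) K X' ∧ dsupp (cvsupp adj W) D ⊆ X'),
          (∏ X ∈ D, θ ^ (((slotsIn loc K X).card : ℝ) + β' * ((X \ (slotsIn loc K X).image loc).card : ℝ))) *
            θ ^ (β'' * (((X' \ dsupp (cvsupp adj W) D) ∩ X'.filter fun v => v.isLeft).card : ℝ)) := by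
  refine (norm_Gk_le_of_ineq5144 hR hΔ hnbr hθ0 hθ1 hβ'' ha₀ hsmall h X').trans ?_
  refine mul_le_mul_of_nonneg_left (sum_le_sum fun D _ => ?_) (Real.exp_pos _).le
  refine mul_le_mul_of_nonneg_right ?_ (Real.rpow_nonneg hθ0.le _)
  exact prod_le_prod (fun _ _ => norm_nonneg _) fun X _ => norm_prime_g3_le_of_ineq5144 h (slotsIn loc K X) X

end Leaf

end Literature.MathematicalPhysics.QuantumFieldTheory.BalabanImbrieJaffe1984to88.BIJ88Expansion5143GkBound
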